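import Literature.Probability.RandomPlanarGeometry.SAWStripTMAt
import Literature.Probability.RandomPlanarGeometry.SAWStripTMBound
import HarnessLib

/-!
# The weighted count at fugacity `num/den` is a lower bound for the Kraft sum (soundness)

Topic `Literature/Probability/RandomPlanarGeometry` (soundness of `SAWStripTMAt.lean`; the port of
`SAWStripTMBound.lean` from the hard-coded fugacity `5/13` and scale `2⁶⁴` to the parameters
`num/den` and `S`). By induction over the layers every stored weight is at most `S · X u σ`, the
total weight `Σ q^{#edges}` (`q = num/den`) of the traces of length `u` whose run reaches `σ`
(rounding down only helps), and the accumulator is at most `S` times the sum of `q^{#edges + 1}`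
over the accepted traces. With the tree's `decode_spec` / `decode_inj` (every accepted trace
decodes to a distinct irreducible bridge of span `l`, not longer than `#edges + 1`) this gives, for
`num ≤ den`,

* **`kraft_ge_at`** : `∃ F, (∀ s ∈ F, IsIrrBridge s ∧ xEnd s = l) ∧ dpAt num den S l H r₀ ≤ S · Σ_{s ∈ F} (num/den)^{|s|}`.

The automaton, traces and decoding are the tree's (`SAWStripTM*.lean`); nothing about them is
re-proved here.

## References

* I. Jensen, J. Phys. A 37 (2004) 11521–11529, §2 (Kesten's bound from span-limited
  irreducible bridges, eq. (4)), §2.1 (transfer matrices) [Jensen2004SAWLowerBounds].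
-/

open Finset
open scoped BigOperators

namespace Literature.Probability.RandomPlanarGeometry.SAW

namespace StripTM

variable (num den : ℕ) (l r0 : ℕ)

/-! ### The target quantities at fugacity `q = num/den` -/

/-- The fugacity `num/den` as a real number. [folklore] -/
noncomputable def qAt : ℝ := (num : ℝ) / den

/-- `XAt u σ`: total `q`-weight of the traces of length `u` whose run reaches `σ`. [folklore] -/
noncomputable def XAt (u : ℕ) (σ : State) : ℝ :=
  ∑ cs ∈ bwords u, if runT l r0 0 (initState l) cs = some σ then qAt num den ^ cs.count true else 0

/-- The `q`-weight of the accepted traces of length `≤ N`, with the extra factor for the first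
step. [folklore] -/
noncomputable def accSumAt (N : ℕ) : ℝ :=
  ∑ m ∈ Finset.range N, ∑ t ∈ accLayer l r0 m, qAt num den ^ (t.count true + 1)

variable {num den l r0}

/-- `q ≥ 0`. [folklore] -/
private theorem qAt_nonneg : (0 : ℝ) ≤ qAt num den := by rw [qAt]; positivity

/-- `q ≤ 1` when `num ≤ den`. [folklore] -/
private theorem qAt_le_one (h : num ≤ den) : qAt num den ≤ (1 : ℝ) := by
  rw [qAt]
  rcases Nat.eq_zero_or_pos den with rfl | hd
  · simp
  · rw [div_le_one (by exact_mod_cast hd)]; exact_mod_cast h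

/-- `XAt ≥ 0`. [folklore] -/
private theorem XAt_nonneg (u : ℕ) (σ : State) : 0 ≤ XAt num den l r0 u σ :=
  sum_nonneg fun cs _ => by split_ifs; exact pow_nonneg qAt_nonneg _; exact le_rfl

/-- Rounding down the fugacity factor: `⌊w num/den⌋ ≤ q w`. [folklore] -/
private theorem fugAt_le (w : ℕ) : (fugAt num den w : ℝ) ≤ qAt num den * w := by
  rw [fugAt, qAt]
  calc ((w * num / den : ℕ) : ℝ) ≤ (w * num : ℕ) / den := Nat.cast_div_le
    _ = num / den * w := by push_cast; ring

/-! ### Semantics of one layer -/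

/-- The weight after a choice. [folklore] -/
def wtNAt (num den : ℕ) (w : ℕ) (e : Bool) : ℕ := if e then fugAt num den w else w

/-- `addChoiceAt`, first component. [folklore] -/
private theorem addChoiceAt_getD (u : ℕ) (σ : State) (w : ℕ) (e : Bool) (p : Std.HashMap State ℕ × ℕ) (σ' : State) :
    (addChoiceAt num den l r0 u σ w e p).1.getD σ' 0 =
      p.1.getD σ' 0 + if step l r0 u σ e = .next σ' then wtNAt num den w e else 0 := by
  unfold addChoiceAt
  cases hs : step l r0 u σ e with
  | dead => simp
  | complete => simp
  | next σ'' =>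
    simp only [wtNAt]
    rw [Std.HashMap.getD_alter]
    by_cases h : σ'' = σ'
    · subst h; simp [Std.HashMap.getD_eq_getD_getElem?]
    · rw [if_neg (by simpa using h), if_neg (by intro e; exact h (Res.next.inj e))]; simp

/-- `addChoiceAt`, second component. [folklore] -/
private theorem addChoiceAt_snd (u : ℕ) (σ : State) (w : ℕ) (e : Bool) (p : Std.HashMap State ℕ × ℕ) :
    (addChoiceAt num den l r0 u σ w e p).2 =
      p.2 + if step l r0 u σ e = .complete then fugAt num den (wtNAt num den w e) else 0 := by
  unfold addChoiceAt
  cases hs : step l r0 u σ e with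
  | dead => simp
  | complete => simp [wtNAt]
  | next σ'' => simp

/-- The contribution of an entry to the key `σ'` of the next layer. [folklore] -/
def contribNAt (num den l r0 u : ℕ) (σ : State) (w : ℕ) (σ' : State) : ℕ :=
  ∑ e : Bool, if step l r0 u σ e = .next σ' then wtNAt num den w e else 0

/-- The contribution of an entry to the accumulator. [folklore] -/
def complNAt (num den l r0 u : ℕ) (σ : State) (w : ℕ) : ℕ :=
  ∑ e : Bool, if step l r0 u σ e = .complete then fugAt num den (wtNAt num den w e) else 0

/-- **Semantics of a layer**: per-key sums and the accumulator. [folklore] -/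
private theorem layerOfListAt_spec (u : ℕ) (es : List (State × ℕ)) (acc : ℕ) (σ' : State) :
    (layerOfListAt num den l r0 u es acc).1.getD σ' 0 =
        (es.map fun sw => contribNAt num den l r0 u sw.1 sw.2 σ').sum ∧
      (layerOfListAt num den l r0 u es acc).2 =
        acc + (es.map fun sw => complNAt num den l r0 u sw.1 sw.2).sum := by
  unfold layerOfListAt
  suffices key : ∀ (p : Std.HashMap State ℕ × ℕ),
      (es.foldl (fun p sw => addChoiceAt num den l r0 u sw.1 sw.2 true
          (addChoiceAt num den l r0 u sw.1 sw.2 false p)) p).1.getD σ' 0 =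
        p.1.getD σ' 0 + (es.map fun sw => contribNAt num den l r0 u sw.1 sw.2 σ').sum ∧
      (es.foldl (fun p sw => addChoiceAt num den l r0 u sw.1 sw.2 true
          (addChoiceAt num den l r0 u sw.1 sw.2 false p)) p).2 =
        p.2 + (es.map fun sw => complNAt num den l r0 u sw.1 sw.2).sum by
    have := key (Std.HashMap.emptyWithCapacity 4096, acc)
    rw [Std.HashMap.getD_emptyWithCapacity, zero_add] at this
    exact this
  induction es with
  | nil => intro p; simp
  | cons sw es ih =>
    intro p
    rw [List.foldl_cons]
    obtain ⟨h1, h2⟩ := ih (addChoiceAt num den l r0 u sw.1 sw.2 true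
      (addChoiceAt num den l r0 u sw.1 sw.2 false p))
    rw [h1, h2, addChoiceAt_getD, addChoiceAt_getD, addChoiceAt_snd, addChoiceAt_snd]
    simp only [List.map_cons, List.sum_cons, contribNAt, complNAt, Fintype.sum_bool]
    constructor <;> ring

/-- Peeling the last layer of `runFromAt`. [folklore] -/
private theorem runFromAt_succ (u n : ℕ) (p : Std.HashMap State ℕ × ℕ) :
    runFromAt num den l r0 u (n + 1) p = layerAt num den l r0 (u + n) (runFromAt num den l r0 u n p) := by
  induction n generalizing u p with
  | zero => rfl
  | succ n ih =>
    rw [runFromAt, ih (u + 1) (layerAt num den l r0 u p), runFromAt]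
    congr 1; omega

/-! ### The invariant of the dynamic programme -/

/-- `XAt 0`. [folklore] -/
private theorem XAt_zero (σ : State) : XAt num den l r0 0 σ = if σ = initState l then 1 else 0 := by
  rw [XAt]
  have : bwords 0 = {[]} := by ext w; simp [List.length_eq_zero_iff]
  rw [this, sum_singleton]
  simp only [runT, Option.some.injEq, List.count_nil, pow_zero]
  by_cases h : σ = initState l
  · subst h; simp
  · rw [if_neg (Ne.symm h), if_neg h]

/-- `XAt (u+1)` by the last letter. [folklore] -/
private theorem XAt_succ (u : ℕ) (σ' : State) :
    XAt num den l r0 (u + 1) σ' = ∑ cs ∈ bwords u, ∑ e : Bool,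
      if (∃ σ, runT l r0 0 (initState l) cs = some σ ∧ step l r0 u σ e = .next σ') then
        qAt num den ^ (cs.count true + if e then 1 else 0) else 0 := by
  rw [XAt, sum_bwords_succ]
  refine sum_congr rfl fun cs hcs => sum_congr rfl fun e _ => ?_
  rw [mem_bwords] at hcs
  have hc : (cs ++ [e]).count true = cs.count true + if e then 1 else 0 := by
    rw [List.count_append]; cases e <;> rfl
  simp only [runT_snoc_eq_some_iff, hcs, hc]

/-- The accepted traces of length `u + 1`, `q`-weighted. [folklore] -/
private theorem sum_accLayer_at (u : ℕ) :
    ∑ t ∈ accLayer l r0 u, qAt num den ^ (t.count true + 1) = ∑ cs ∈ bwords u, ∑ e : Bool,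
      if (∃ σ, runT l r0 0 (initState l) cs = some σ ∧ step l r0 u σ e = .complete) then
        qAt num den ^ (cs.count true + (if e then 1 else 0) + 1) else 0 := by
  classical
  rw [accLayer, sum_filter, sum_bwords_succ]
  refine sum_congr rfl fun cs hcs => sum_congr rfl fun e _ => ?_
  rw [mem_bwords] at hcs
  have hc : [e].count true = if e then 1 else 0 := by cases e <;> rfl
  have hiff : Accepts l r0 (cs ++ [e]) ↔
      ∃ σ, runT l r0 0 (initState l) cs = some σ ∧ step l r0 u σ e = .complete := by
    constructor
    · rintro ⟨init, e', σ, h, hr, hs⟩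
      obtain ⟨rfl, he⟩ := List.append_inj' h rfl
      simp only [List.cons.injEq, and_true] at he
      subst he; rw [hcs] at hs; exact ⟨σ, hr, hs⟩
    · rintro ⟨σ, hr, hs⟩; exact ⟨cs, e, σ, rfl, hr, hcs ▸ hs⟩
  by_cases h : Accepts l r0 (cs ++ [e])
  · rw [if_pos h, if_pos (hiff.1 h), List.count_append, hc]
  · rw [if_neg h, if_neg (fun h' => h (hiff.2 h'))]

/-- **The invariant of the dynamic programme** at fugacity `num/den` and scale `S`.
[cite: Jensen2004SAWLowerBounds, §2] -/
theorem dpAt_invariant (S : ℕ) (u : ℕ) :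
    (∀ σ, (((runFromAt num den l r0 0 u ((Std.HashMap.emptyWithCapacity 16).insert (initState l) S, 0)).1.getD σ 0 : ℕ) : ℝ)
        ≤ (S : ℝ) * XAt num den l r0 u σ) ∧
    (((runFromAt num den l r0 0 u ((Std.HashMap.emptyWithCapacity 16).insert (initState l) S, 0)).2 : ℕ) : ℝ)
        ≤ (S : ℝ) * accSumAt num den l r0 u := by
  induction u with
  | zero =>
    constructor
    · intro σ
      simp only [runFromAt, XAt_zero]
      rw [Std.HashMap.getD_insert]
      by_cases h : σ = initState l
      · subst h; simp
      · rw [if_neg (by simpa using Ne.symm h), Std.HashMap.getD_emptyWithCapacity, if_neg h]; simp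
    · simp [runFromAt, accSumAt]
  | succ u ih =>
    obtain ⟨ih1, ih2⟩ := ih
    set P := runFromAt num den l r0 0 u ((Std.HashMap.emptyWithCapacity 16).insert (initState l) S, 0) with hP
    rw [runFromAt_succ, zero_add, ← hP]
    have hsem := fun σ' => layerOfListAt_spec (num := num) (den := den) (l := l) (r0 := r0) u P.1.toList P.2 σ'
    -- the entries of the old layer
    set es := P.1.toList with hes
    have hkeys : (es.map Prod.fst).Nodup := by
      rw [hes, Std.HashMap.map_fst_toList_eq_keys]; exact Std.HashMap.nodup_keys
    have hval : ∀ sw ∈ es, ((sw.2 : ℕ) : ℝ) ≤ (S : ℝ) * XAt num den l r0 u sw.1 := by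
      rintro ⟨σ, w⟩ hsw
      have h1 : P.1[σ]? = some w := Std.HashMap.mem_toList_iff_getElem?_eq_some.1 hsw
      have h2 : P.1.getD σ 0 = w := by rw [Std.HashMap.getD_eq_getD_getElem?, h1]; rfl
      rw [← h2]; exact ih1 σ
    have hS : (0 : ℝ) ≤ S := Nat.cast_nonneg S
    -- a list sum of a function of the key is a finset sum over the keys
    have hlist : ∀ g : State → ℝ, (es.map fun sw => g sw.1).sum = ∑ σ ∈ (es.map Prod.fst).toFinset, g σ := by
      intro g; rw [List.sum_toFinset _ hkeys, List.map_map]; rfl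
    -- at most one key is the run of a given trace
    have hone : ∀ (cs : List Bool) (a : ℝ), 0 ≤ a →
        ∑ σ ∈ (es.map Prod.fst).toFinset, (if runT l r0 0 (initState l) cs = some σ then a else 0) ≤ a := by
      intro cs a ha
      cases hr : runT l r0 0 (initState l) cs with
      | none => simp [ha]
      | some σ₀ =>
        simp only [Option.some.injEq]
        rw [show (fun σ => if σ₀ = σ then a else 0) = fun σ => if σ = σ₀ then a else 0 from
          funext fun σ => by simp only [eq_comm], Finset.sum_ite_eq']
        split_ifs; exact le_rfl; exact ha
    constructor
    · intro σ'
      rw [layerAt, (hsem σ').1]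
      -- bound each entry
      have step1 : (((es.map fun sw => contribNAt num den l r0 u sw.1 sw.2 σ').sum : ℕ) : ℝ) ≤
          (es.map fun sw => (S : ℝ) * ∑ e : Bool,
            (if step l r0 u sw.1 e = .next σ' then qAt num den ^ (if e then 1 else 0) else 0) *
              XAt num den l r0 u sw.1).sum := by
        rw [Nat.cast_list_sum, List.map_map]
        apply List.sum_le_sum
        rintro ⟨σ, w⟩ hsw
        have hw := hval _ hsw
        simp only [Function.comp_apply, contribNAt, Fintype.sum_bool, Nat.cast_add, wtNAt]
        simp only [Bool.false_eq_true, if_false, if_true, pow_one, pow_zero]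
        have hX := XAt_nonneg (num := num) (den := den) (l := l) (r0 := r0) u σ
        have hf := fugAt_le (num := num) (den := den) w
        have hq := qAt_nonneg (num := num) (den := den)
        split_ifs <;> push_cast <;> nlinarith [hf, hX, hw, hq, hS, mul_nonneg hq hS]
      refine le_trans step1 ?_
      rw [hlist (fun σ => (S : ℝ) * ∑ e : Bool, (if step l r0 u σ e = .next σ' then
          qAt num den ^ (if e then 1 else 0) else 0) * XAt num den l r0 u σ), ← mul_sum, XAt_succ]
      refine mul_le_mul_of_nonneg_left ?_ hS
      -- expand X and exchange the sums
      set K := (es.map Prod.fst).toFinset with hK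
      set T : State → Bool → List Bool → ℝ := fun σ e cs =>
        (if step l r0 u σ e = .next σ' then qAt num den ^ (if e then 1 else 0) else 0) *
          (if runT l r0 0 (initState l) cs = some σ then qAt num den ^ cs.count true else 0) with hT
      have hex : ∑ σ ∈ K, ∑ e : Bool,
          (if step l r0 u σ e = .next σ' then qAt num den ^ (if e then 1 else 0) else 0) *
            XAt num den l r0 u σ =
          ∑ cs ∈ bwords u, ∑ e : Bool, ∑ σ ∈ K, T σ e cs := by
        have e0 : ∀ σ e, (if step l r0 u σ e = .next σ' then qAt num den ^ (if e then 1 else 0) else 0) *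
            XAt num den l r0 u σ = ∑ cs ∈ bwords u, T σ e cs := fun σ e => by rw [XAt, mul_sum]
        simp only [e0]
        have e1 : ∑ σ ∈ K, ∑ e : Bool, ∑ cs ∈ bwords u, T σ e cs =
            ∑ σ ∈ K, ∑ cs ∈ bwords u, ∑ e : Bool, T σ e cs := sum_congr rfl fun σ _ => sum_comm
        have e2 : ∑ σ ∈ K, ∑ cs ∈ bwords u, ∑ e : Bool, T σ e cs =
            ∑ cs ∈ bwords u, ∑ σ ∈ K, ∑ e : Bool, T σ e cs := sum_comm
        have e3 : ∑ cs ∈ bwords u, ∑ σ ∈ K, ∑ e : Bool, T σ e cs =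
            ∑ cs ∈ bwords u, ∑ e : Bool, ∑ σ ∈ K, T σ e cs := sum_congr rfl fun cs _ => sum_comm
        rw [e1, e2, e3]
      rw [hex]
      simp only [hT]
      refine sum_le_sum fun cs _ => sum_le_sum fun e _ => ?_
      -- at most one key matches the run of `cs`
      have key : ∀ σ, (if step l r0 u σ e = .next σ' then qAt num den ^ (if e then 1 else 0) else 0) *
          (if runT l r0 0 (initState l) cs = some σ then qAt num den ^ cs.count true else 0) =
          if runT l r0 0 (initState l) cs = some σ then
            (if (∃ σ₀, runT l r0 0 (initState l) cs = some σ₀ ∧ step l r0 u σ₀ e = .next σ') then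
              qAt num den ^ (cs.count true + if e then 1 else 0) else 0) else 0 := by
        intro σ
        by_cases hr : runT l r0 0 (initState l) cs = some σ
        · rw [if_pos hr, if_pos hr]
          by_cases hs : step l r0 u σ e = .next σ'
          · rw [if_pos hs, if_pos (show ∃ σ₀, runT l r0 0 (initState l) cs = some σ₀ ∧
              step l r0 u σ₀ e = .next σ' from ⟨σ, hr, hs⟩), pow_add, mul_comm]
          · rw [if_neg hs, zero_mul, if_neg]; rintro ⟨σ₀, h₀, h₁⟩
            rw [hr] at h₀; cases h₀; exact hs h₁
        · rw [if_neg hr, if_neg hr, mul_zero]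
      simp only [key]
      exact hone cs _ (by split_ifs <;> first | exact pow_nonneg qAt_nonneg _ | exact le_rfl)
    · rw [layerAt, (hsem (initState l)).2, Nat.cast_add, accSumAt, sum_range_succ, mul_add, ← accSumAt]
      refine add_le_add ih2 ?_
      have step1 : (((es.map fun sw => complNAt num den l r0 u sw.1 sw.2).sum : ℕ) : ℝ) ≤
          (es.map fun sw => (S : ℝ) * ∑ e : Bool,
            (if step l r0 u sw.1 e = .complete then qAt num den ^ ((if e then 1 else 0) + 1) else 0) *
              XAt num den l r0 u sw.1).sum := by
        rw [Nat.cast_list_sum, List.map_map]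
        apply List.sum_le_sum
        rintro ⟨σ, w⟩ hsw
        have hw := hval _ hsw
        simp only [Function.comp_apply, complNAt, Fintype.sum_bool, Nat.cast_add, wtNAt]
        simp only [Bool.false_eq_true, if_false, if_true, zero_add]
        have hX := XAt_nonneg (num := num) (den := den) (l := l) (r0 := r0) u σ
        have hf := fugAt_le (num := num) (den := den) w
        have hf2 := fugAt_le (num := num) (den := den) (fugAt num den w)
        have hq := qAt_nonneg (num := num) (den := den)
        have hf0 : (0 : ℝ) ≤ fugAt num den w := Nat.cast_nonneg _
        split_ifs <;> push_cast <;>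
          nlinarith [hf, hf2, hX, hw, hq, hS, hf0, mul_nonneg hq hq, pow_two (qAt num den),
            mul_nonneg hq hS, mul_nonneg (mul_nonneg hq hq) hS, mul_le_mul_of_nonneg_left hf hq,
            mul_le_mul_of_nonneg_left hw hq, mul_le_mul_of_nonneg_left hw (mul_nonneg hq hq)]
      refine le_trans step1 ?_
      rw [hlist (fun σ => (S : ℝ) * ∑ e : Bool, (if step l r0 u σ e = .complete then
          qAt num den ^ ((if e then 1 else 0) + 1) else 0) * XAt num den l r0 u σ), ← mul_sum, sum_accLayer_at]
      refine mul_le_mul_of_nonneg_left ?_ hS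
      set K := (es.map Prod.fst).toFinset with hK
      set T : State → Bool → List Bool → ℝ := fun σ e cs =>
        (if step l r0 u σ e = .complete then qAt num den ^ ((if e then 1 else 0) + 1) else 0) *
          (if runT l r0 0 (initState l) cs = some σ then qAt num den ^ cs.count true else 0) with hT
      have hex : ∑ σ ∈ K, ∑ e : Bool,
          (if step l r0 u σ e = .complete then qAt num den ^ ((if e then 1 else 0) + 1) else 0) *
            XAt num den l r0 u σ =
          ∑ cs ∈ bwords u, ∑ e : Bool, ∑ σ ∈ K, T σ e cs := by
        have e0 : ∀ σ e, (if step l r0 u σ e = .complete then qAt num den ^ ((if e then 1 else 0) + 1) else 0) *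
            XAt num den l r0 u σ = ∑ cs ∈ bwords u, T σ e cs := fun σ e => by rw [XAt, mul_sum]
        simp only [e0]
        have e1 : ∑ σ ∈ K, ∑ e : Bool, ∑ cs ∈ bwords u, T σ e cs =
            ∑ σ ∈ K, ∑ cs ∈ bwords u, ∑ e : Bool, T σ e cs := sum_congr rfl fun σ _ => sum_comm
        have e2 : ∑ σ ∈ K, ∑ cs ∈ bwords u, ∑ e : Bool, T σ e cs =
            ∑ cs ∈ bwords u, ∑ σ ∈ K, ∑ e : Bool, T σ e cs := sum_comm
        have e3 : ∑ cs ∈ bwords u, ∑ σ ∈ K, ∑ e : Bool, T σ e cs =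
            ∑ cs ∈ bwords u, ∑ e : Bool, ∑ σ ∈ K, T σ e cs := sum_congr rfl fun cs _ => sum_comm
        rw [e1, e2, e3]
      rw [hex]
      simp only [hT]
      refine sum_le_sum fun cs _ => sum_le_sum fun e _ => ?_
      have key : ∀ σ, (if step l r0 u σ e = .complete then qAt num den ^ ((if e then 1 else 0) + 1) else 0) *
          (if runT l r0 0 (initState l) cs = some σ then qAt num den ^ cs.count true else 0) =
          if runT l r0 0 (initState l) cs = some σ then
            (if (∃ σ₀, runT l r0 0 (initState l) cs = some σ₀ ∧ step l r0 u σ₀ e = .complete) then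
              qAt num den ^ (cs.count true + (if e then 1 else 0) + 1) else 0) else 0 := by
        intro σ
        by_cases hr : runT l r0 0 (initState l) cs = some σ
        · rw [if_pos hr, if_pos hr]
          by_cases hs : step l r0 u σ e = .complete
          · rw [if_pos hs, if_pos (show ∃ σ₀, runT l r0 0 (initState l) cs = some σ₀ ∧
              step l r0 u σ₀ e = .complete from ⟨σ, hr, hs⟩)]
            ring
          · rw [if_neg hs, zero_mul, if_neg]; rintro ⟨σ₀, h₀, h₁⟩
            rw [hr] at h₀; cases h₀; exact hs h₁
        · rw [if_neg hr, if_neg hr, mul_zero]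
      simp only [key]
      exact hone cs _ (by split_ifs <;> first | exact pow_nonneg qAt_nonneg _ | exact le_rfl)

/-- **`dpAt ≤ S · accSumAt`.** [cite: Jensen2004SAWLowerBounds, §2] -/
theorem dpAt_le_accSumAt (S H : ℕ) :
    ((dpAt num den l r0 S H : ℕ) : ℝ) ≤ (S : ℝ) * accSumAt num den l r0 (2 * l * H) :=
  (dpAt_invariant S (2 * l * H)).2

/-! ### The Kraft sum -/

/-- **The Kraft sum of the decoded irreducible bridges dominates the weighted count** at fugacity
`num/den ≤ 1`: for `l ≥ 2` there is a finite set `F` of irreducible bridges of span `l` (the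
decoded accepted traces) with `dpAt num den S l H r₀ ≤ S · Σ_{s ∈ F} (num/den)^{|s|}`.
[cite: Jensen2004SAWLowerBounds, §2, eq. (4)] -/
theorem kraft_ge_at (hl : 2 ≤ l) (hq : num ≤ den) (S H : ℕ) :
    ∃ F : Finset (List Step), (∀ s ∈ F, IsIrrBridge s ∧ xEnd s = l) ∧
      ((dpAt num den l r0 S H : ℕ) : ℝ) ≤ (S : ℝ) * ∑ s ∈ F, ((num : ℝ) / den) ^ s.length := by
  classical
  refine ⟨(accTraces l r0 (2 * l * H)).image (decode l r0), ?_, ?_⟩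
  · intro s hs
    obtain ⟨t, ht, rfl⟩ := mem_image.1 hs
    rw [accTraces, mem_biUnion] at ht
    obtain ⟨m, -, ht⟩ := ht
    rw [accLayer, mem_filter] at ht
    have := decode_spec hl ht.2
    exact ⟨this.1, this.2.1⟩
  · refine le_trans (dpAt_le_accSumAt S H) (mul_le_mul_of_nonneg_left ?_ (Nat.cast_nonneg S))
    have hacc : ∀ t ∈ accTraces l r0 (2 * l * H), Accepts l r0 t := by
      intro t ht
      rw [accTraces, mem_biUnion] at ht
      obtain ⟨m, -, ht⟩ := ht
      rw [accLayer, mem_filter] at ht; exact ht.2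
    rw [sum_image fun t ht t' ht' h => decode_inj hl (hacc t ht) (hacc t' ht') h]
    rw [accSumAt, accTraces, sum_biUnion]
    · refine sum_le_sum fun m _ => sum_le_sum fun t ht => ?_
      rw [accLayer, mem_filter] at ht
      have h3 := (decode_spec hl ht.2).2.2
      rw [edgesN_length] at h3
      rw [show qAt num den = (num : ℝ) / den from rfl]
      exact pow_le_pow_of_le_one (qAt_nonneg (num := num) (den := den)) (qAt_le_one hq) h3
    · intro m _ m' _ hne
      simp only [Function.onFun]
      rw [Finset.disjoint_left]
      intro t h1 h2
      rw [accLayer, mem_filter, mem_bwords] at h1 h2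
      omega

end StripTM

end Literature.Probability.RandomPlanarGeometry.SAW
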